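import Summits.Langlands.Langlands.Theorems.ParityBlindBianchiIcosahedralDescentLevelTarget
import Summits.Langlands.Langlands.Theorems.ParityBlindBianchiIcosahedralDescentLevelStatus
import Literature.NumberTheory.Automorphic.CuspidalRepGL2ExistsProofs

/-!
# The crux `IcosahedralDescentLevel` (stmt-Langlands-15113) AS TYPED is UNCONDITIONALLY equivalent,
# by name, to the open target `GaloisWeightedBE.StrongArtinIcosahedralQ` (stmt-Langlands-10841)

Status file of the line `Sketch` (lead prover, continuation seat c3; `--supports stmt-Langlands-15113`).

Seat c2 landed (`…IcosahedralDescentLevelTarget`, p115933) the by-name equivalence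
`IcosahedralDescentLevel ↔ StrongArtinIcosahedralQ` GRANTED the named fact
`nonempty_cuspidalAutomorphicRepData_two` (cusp forms exist on `GL₂` over every number field), and seat
c1 (`…IcosahedralDescentLevelStatus`, p114504) the equivalence with all-parity icosahedral strong Artin
granted bare cuspidal inhabitation over the 2-split imaginary quadratic fields.

That named fact is no longer a hypothesis: the tree PROVES it —
`Literature.NumberTheory.Automorphic.nonempty_cuspidalAutomorphicRepData_two_holds`
(`CuspidalRepGL2ExistsProofs`: the supercusp-form principle of Jacquet–Langlands §16 / Gelbart §10
applied to the explicit local supercusp form of `GL2LocalSupercuspForm`; `L²_cusp ≠ 0` and a non-zero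
cuspidal subspace yields a Borel–Jacquet datum), and the compactness proof typing the datum is the
tree's `isCompact_glFiniteIntegralLevel_holds`.  Discharging both hypotheses gives, with NO hypothesis
left:

* `cuspidalData_inhabited_two` — every number field carries a cuspidal automorphic representation
  datum of `GL₂` (the inhabitation hypothesis of p114504 / the refuters' door, discharged);
* `iff_strongArtinIcosahedralQ` — `IcosahedralDescentLevel ↔ StrongArtinIcosahedralQ`: the rank-5 crux
  of `ParityBlindBianchi` AS TYPED *is* the rank-0 open target of `GaloisWeightedBE` (strong Artin, a.e.,
  for EVERY irreducible icosahedral `ρ : Γ_ℚ → GL₂(ℂ)`, odd or even);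
* `iff_allParityArtin` — the same with the target's binders spelled out (p114504 made unconditional);
* `evenIcosahedralStrongArtin_of_icosahedralDescentLevel'` — the typed crux ALONE gives this route's
  rank-0 target `EvenIcosahedralStrongArtin` (stmt-Langlands-2903): in the deciding theorem `closes`
  the cruxes E1′ `ResidualBianchiDoorLevel`, E2′ `TwoAdicBianchiProModularityLevel`, R′
  `ArtinWeightRealisationLevel` are idle as typed;
* `door_iff_strongArtinIcosahedralQ` — the skeleton's one non-fact stub (the "door": bare per-field data
  ⟹ a.e. strong Artin for `ρ`) is, unconditionally, `StrongArtinIcosahedralQ` again.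

Consequence for the item: stmt-Langlands-15113 as typed closes EXACTLY when stmt-Langlands-10841 closes
(one line either way, this file), and no base-change fact, no line and no stub can contribute anything
to it; the intended statement is the repaired D″ (`∃ S₀, (0 : ℕ) ∉ S₀ ∧ …`), landed modulo the four
Arthur–Clozel facts as `icosahedralDescentLevel_repaired` (p111861), restatement package on the item (c1).
-/

-- `Summit.Langlands.Langlands.…`: the repeated path component is the tree's layout (D-0017).
set_option linter.dupNamespace false

noncomputable section

open scoped MatrixGroups NumberField
open NumberField IsDedekindDomain Field Filter
open Literature.NumberTheory.Automorphic Literature.NumberTheory.GaloisRepresentations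
open Summit.Langlands.Langlands.Theses.ParityBlindBianchi
open Summit.Langlands.Langlands.Theses.GaloisWeightedBE (StrongArtinIcosahedralQ)

namespace Summit.Langlands.Langlands.Theorems.IcosahedralDescentLevel

/-- **Cuspidal data of `GL₂` exist over every number field, unconditionally** (the inhabitation
hypothesis of `iff_allParityArtin_of_inhabited` and of the refuters' door, discharged): the compactness
of `GL₂(𝒪̂_K)` is the tree's theorem `isCompact_glFiniteIntegralLevel_holds`, and a cuspidal automorphic
representation datum exists by the tree's theorem `nonempty_cuspidalAutomorphicRepData_two_holds`
(Gelbart 1975, Thm. 7.11, proved in `CuspidalRepGL2ExistsProofs` by the supercusp-form principle).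
[cite: Gelbart1975, Thm. 7.11] -/
theorem cuspidalData_inhabited_two (K : Type) [Field K] [NumberField K] :
    ∃ hcpt : isCompact_glFiniteIntegralLevel 2 K, Nonempty (CuspidalAutomorphicRepData 2 K hcpt) :=
  ⟨isCompact_glFiniteIntegralLevel_holds 2 K,
    nonempty_cuspidalAutomorphicRepData_two_holds K (isCompact_glFiniteIntegralLevel_holds 2 K)⟩

/-- **The typed crux IS the sibling route's open target, unconditionally.**
`ParityBlindBianchi.IcosahedralDescentLevel` (stmt-Langlands-15113, rank 5, billed "theorem-sized
uniform descent") is EQUIVALENT — no hypothesis — to `GaloisWeightedBE.StrongArtinIcosahedralQ`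
(stmt-Langlands-10841, rank-0 target: a.e. strong Artin for every irreducible icosahedral
`ρ : Γ_ℚ → GL₂(ℂ)`, whose even case is open).  This is c2's `icosahedralDescentLevel_iff_strongArtinIcosahedralQ`
with its only hypothesis `nonempty_cuspidalAutomorphicRepData_two` discharged by the tree's proof
`nonempty_cuspidalAutomorphicRepData_two_holds`. [folklore] -/
theorem iff_strongArtinIcosahedralQ : IcosahedralDescentLevel ↔ StrongArtinIcosahedralQ :=
  icosahedralDescentLevel_iff_strongArtinIcosahedralQ nonempty_cuspidalAutomorphicRepData_two_holds

/-- **The typed crux is all-parity icosahedral strong Artin over `ℚ`, unconditionally** (binders of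
the route target spelled out; c1's `iff_allParityArtin_of_inhabited` with its inhabitation hypothesis
discharged by `cuspidalData_inhabited_two`): every irreducible `ρ : Γ_ℚ → GL₂(ℂ)` with projective
image `A₅`, of EITHER parity, has a cuspidal `π` on `GL₂(𝔸_ℚ)` with
`satakePolynomial (t_{π,v}) = charpoly ρ(Frob_v)` at cofinitely many `v`.  No base-change fact and no
part of the crux's uniform-family hypothesis enters. [folklore] -/
theorem iff_allParityArtin :
    IcosahedralDescentLevel ↔
      ∀ ρ : FramedGaloisRep ℚ ℂ 2, ρ.toGaloisRep.IsIrreducible →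
        Nonempty ((Matrix.ProjGenLinGroup.mk.comp ρ.toMonoidHom).range ≃* alternatingGroup (Fin 5)) →
        ∃ (hcpt : isCompact_glFiniteIntegralLevel 2 ℚ) (π : CuspidalAutomorphicRepData 2 ℚ hcpt),
          ∀ᶠ v : HeightOneSpectrum (𝓞 ℚ) in cofinite, ∃ α : Multiset ℂ,
            π.1.HasSatakeParamAt v α ∧ ρ.IsUnramifiedAt v ∧
              ρ.HasFrobCharpolyAt v (satakePolynomial α) :=
  iff_allParityArtin_of_inhabited fun K _ _ _ _ _ => cuspidalData_inhabited_two K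

/-- **The typed crux ALONE gives this route's rank-0 target, unconditionally.**
`IcosahedralDescentLevel → EvenIcosahedralStrongArtin` (stmt-Langlands-2903) with no hypothesis: in the
deciding theorem `closes` of `ParityBlindBianchi` the cruxes E1′, E2′, R′ and the evenness hypothesis
are idle as typed. [folklore] -/
theorem evenIcosahedralStrongArtin_of_icosahedralDescentLevel' (hD : IcosahedralDescentLevel) :
    EvenIcosahedralStrongArtin :=
  evenIcosahedralStrongArtin_of_icosahedralDescentLevel nonempty_cuspidalAutomorphicRepData_two_holds hD

/-- **The skeleton's door stub is `StrongArtinIcosahedralQ`, unconditionally.**  The one registered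
stub of the line `Sketch` that is not a named base-change fact — a.e. strong Artin for every
irreducible icosahedral `ρ/ℚ` granted, over every 2-split imaginary quadratic `K`, a 2-adic model of
`ρ|_K` and SOME cuspidal datum (the second conjunct of
`Negative.icosahedralDescentLevel_iff_repaired_and_door`) — is equivalent to the sibling target: its
per-field data exist for free (`Negative.exists_entrywise_twoAdicModel`, `cuspidalData_inhabited_two`).
So the typed crux = (repaired D″) ∧ (stmt-Langlands-10841), and since stmt-Langlands-10841 implies the
typed crux outright, D″ and the four Arthur–Clozel facts are irrelevant to the item AS TYPED.
[folklore] -/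
theorem door_iff_strongArtinIcosahedralQ :
    (∀ (ι : PadicAlgCl 2 ≃+* ℂ) (ρ : FramedGaloisRep ℚ ℂ 2), ρ.toGaloisRep.IsIrreducible →
        Nonempty ((Matrix.ProjGenLinGroup.mk.comp ρ.toMonoidHom).range ≃* alternatingGroup (Fin 5)) →
        (∀ (K : Type) [Field K] [NumberField K], NumberField.IsTotallyComplex K →
          Module.finrank ℚ K = 2 →
          (∃ v w : HeightOneSpectrum (𝓞 K), v ≠ w ∧ ((2 : ℕ) : 𝓞 K) ∈ v.asIdeal ∧
            ((2 : ℕ) : 𝓞 K) ∈ w.asIdeal) →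
          ∃ (σ : FramedGaloisRep K (PadicAlgCl 2) 2) (hcpt : isCompact_glFiniteIntegralLevel 2 K)
            (_π : CuspidalAutomorphicRepData 2 K hcpt),
            ∀ (g : absoluteGaloisGroup K) (i j : Fin 2),
              ι ((σ g).val i j) = ((FramedGaloisRep.restrictField K ρ) g).val i j) →
        ∃ (hcpt : isCompact_glFiniteIntegralLevel 2 ℚ) (π : CuspidalAutomorphicRepData 2 ℚ hcpt),
          ∀ᶠ v : HeightOneSpectrum (𝓞 ℚ) in cofinite, ∃ α : Multiset ℂ,
            π.1.HasSatakeParamAt v α ∧ ρ.IsUnramifiedAt v ∧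
              ρ.HasFrobCharpolyAt v (satakePolynomial α)) ↔
      StrongArtinIcosahedralQ := by
  constructor
  · intro hdoor ρ hirr hA5
    obtain ⟨ι⟩ := PadicAlgCl.nonempty_ringEquiv_complex 2
    refine hdoor ι ρ hirr ((isIcosahedralType_iff ρ).mp hA5) fun K _ _ _ _ _ => ?_
    obtain ⟨hcpt, ⟨π⟩⟩ := cuspidalData_inhabited_two K
    obtain ⟨σ, hσ⟩ := Negative.exists_entrywise_twoAdicModel ι ρ K
    exact ⟨σ, hcpt, π, hσ⟩
  · intro h _ ρ hirr hA5 _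
    exact h ρ hirr ((isIcosahedralType_iff ρ).mpr hA5)

/-- **Exact unconditional decomposition by name**: the typed crux is its repaired form D″ together
with the sibling target, `IcosahedralDescentLevel ↔ D″ ∧ StrongArtinIcosahedralQ` — the refuters'
`Negative.icosahedralDescentLevel_iff_repaired_and_door` with the door named by
`door_iff_strongArtinIcosahedralQ`.  (D″ is `icosahedralDescentLevel_repaired` modulo F1–F4, p111861.)
[folklore] -/
theorem iff_repaired_and_strongArtinIcosahedralQ :
    IcosahedralDescentLevel ↔
      ((∀ (ι : PadicAlgCl 2 ≃+* ℂ) (ρ : FramedGaloisRep ℚ ℂ 2), ρ.toGaloisRep.IsIrreducible →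
        Nonempty ((Matrix.ProjGenLinGroup.mk.comp ρ.toMonoidHom).range ≃* alternatingGroup (Fin 5)) →
        (∃ S₀ : Finset ℕ, (0 : ℕ) ∉ S₀ ∧ ∀ (K : Type) [Field K] [NumberField K],
          NumberField.IsTotallyComplex K → Module.finrank ℚ K = 2 →
          (∃ v w : HeightOneSpectrum (𝓞 K), v ≠ w ∧ ((2 : ℕ) : 𝓞 K) ∈ v.asIdeal ∧
            ((2 : ℕ) : 𝓞 K) ∈ w.asIdeal) →
          ∃ (σ : FramedGaloisRep K (PadicAlgCl 2) 2) (hcpt : isCompact_glFiniteIntegralLevel 2 K)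
            (π : CuspidalAutomorphicRepData 2 K hcpt),
            (∀ (g : absoluteGaloisGroup K) (i j : Fin 2),
              ι ((σ g).val i j) = ((FramedGaloisRep.restrictField K ρ) g).val i j) ∧
            ∀ w : HeightOneSpectrum (𝓞 K), (∀ ℓ ∈ S₀, ((ℓ : ℕ) : 𝓞 K) ∉ w.asIdeal) →
              Summit.Langlands.SatakeFrobCompatibleAt ι π.1 σ w) →
        ∃ (hcpt : isCompact_glFiniteIntegralLevel 2 ℚ) (π : CuspidalAutomorphicRepData 2 ℚ hcpt),
          ∀ᶠ v : HeightOneSpectrum (𝓞 ℚ) in cofinite, ∃ α : Multiset ℂ,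
            π.1.HasSatakeParamAt v α ∧ ρ.IsUnramifiedAt v ∧
              ρ.HasFrobCharpolyAt v (satakePolynomial α)) ∧
      StrongArtinIcosahedralQ) := by
  rw [Negative.icosahedralDescentLevel_iff_repaired_and_door, door_iff_strongArtinIcosahedralQ]

end Summit.Langlands.Langlands.Theorems.IcosahedralDescentLevel

end
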